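import Literature.AlgebraicGeometry.Motives.AbelianVarietyBrauerRelationDimensionsAnyField
import Literature.AlgebraicGeometry.Motives.AbelianVarietyTateModuleFaithful
import HarnessLib

/-!
# The inner product of `ℓ`-adic characters counts equivariant homomorphisms of Tate modules:
# `|G| · rk_{ℤ_ℓ} Hom_{ℤ_ℓ[G]}(T_ℓ X, T_ℓ Y) = Σ_{g ∈ G} χ_ℓ^Y(g) χ_ℓ^X(g⁻¹)`, and the bound
# `rk_ℤ Hom_G(X, Y) ≤ rk_{ℤ_ℓ} Hom_{ℤ_ℓ[G]}(T_ℓ X, T_ℓ Y)`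

For abelian varieties `X`, `Y` over a field `K` with actions `ρ_X : G → End X`, `ρ_Y : G → End Y` of a finite group and a
prime `ℓ` invertible in `K`, the finite group `G` acts on the free `ℤ_ℓ`-module `Hom_{ℤ_ℓ}(T_ℓ X, T_ℓ Y)` by
`g · f = T_ℓ ρ_Y(g) ∘ f ∘ T_ℓ ρ_X(g⁻¹)`, with invariants the equivariant maps `Hom_{ℤ_ℓ[G]}(T_ℓ X, T_ℓ Y)` and with character
`g ↦ χ_ℓ^Y(g) · χ_ℓ^X(g⁻¹)` (§2: the trace of `f ↦ A ∘ f ∘ B` on `Hom(M, N)` is `Tr A · Tr B`, through `Hom(M, N) ≅ M^∨ ⊗ N`).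
The general lattice form of "the multiplicity of the trivial representation is the average of the character" (§1, for any
representation `τ` of a finite group on a free `ℤ_ℓ`-module `M` of finite rank:
**`|G| · rk_{ℤ_ℓ} M^G = Σ_g Tr(τ(g) | M)`**, proved as for `M = T_ℓ X` in
`Motives/AbelianVarietyTateModuleTraceDimensionFormula` §4: the norm `N = Σ_g τ(g)` satisfies `N² = |G| N`, `Im N ⊆ M^G`,
`|G| M^G ⊆ Im N`, and `Tr N = |G| rk Im N` by tracing both composites of `M ↠ Im N ↪ M`) then gives (§3)

  **`|G| · rk_{ℤ_ℓ} Hom_{ℤ_ℓ[G]}(T_ℓ X, T_ℓ Y) = Σ_{g ∈ G} χ_ℓ^Y(g) χ_ℓ^X(g⁻¹)`**   (`card_mul_finrank_equivariantTateHom_eq_sum`)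

— the `ℓ`-adic INNER PRODUCT `⟨χ_X, χ_Y⟩` — and Mumford's §19 Thm. 3 (`ℤ_ℓ ⊗ Hom(X, Y) ↪ Hom(T_ℓ X, T_ℓ Y)`, the tree's
`faltingsTateMap_injective_holds`, with `Hom(X, Y)` free of finite rank, `module_free_hom_holds` / `module_finite_hom_holds`,
and `ℤ_ℓ` flat over `ℤ`) restricted to the `G`-equivariant homomorphisms `Hom_G(X, Y) = {f | ρ_X(g) ≫ f = f ≫ ρ_Y(g) ∀ g}`
yields the BOUND (§4)

  **`rk_ℤ Hom_G(X, Y) ≤ rk_{ℤ_ℓ} Hom_{ℤ_ℓ[G]}(T_ℓ X, T_ℓ Y)`**   (`finrank_equivariantHom_le`),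

i.e. `|G| · rk_ℤ Hom_G(X, Y) ≤ ⟨χ_X, χ_Y⟩_ℓ`, with equality whenever Tate's conjecture holds for `(X, Y)` over `K` (finite
fields: Tate; number fields: Faltings — not used and not asserted here).  For `X = Y`, `ρ_X = ρ_Y = ρ`:
`|G| · rk_ℤ End_G(X) ≤ Σ_g χ_ℓ(g) χ_ℓ(g⁻¹)`.

## Main statements (sorry-free; theorems only, no new definitions)

* §1 (any representation `τ : G →* End_{ℤ_ℓ}(M)`, `M` free of finite rank) `sum_mul_apply_eq_sum`, `apply_mul_sum_eq_sum`,
  `sum_mul_sum_eq_card_smul`, `range_sum_le_iInf_eqLocus`, `sum_apply_of_mem_iInf_eqLocus`,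
  `trace_sum_eq_card_mul_finrank_range`, `finrank_range_sum_eq_finrank_iInf_eqLocus`,
  **`card_mul_finrank_iInf_eqLocus_eq_sum_trace`** (`|G| rk M^G = Σ_g Tr τ(g)`), and its instance for `M = T_ℓ X`,
  `card_mul_finrank_iInf_eqLocus_tateModuleMap_eq_sum_trace` (no norm endomorphism `N₀ ∈ End X` needed).
* §2 **`trace_llcomp_comp_lcomp`** (`Tr(f ↦ A ∘ f ∘ B | Hom(M, N)) = Tr A · Tr B`, any commutative ring).
* §3 `llcomp_lcomp_apply_eq_iff` (invariants of the conjugation action = equivariant maps),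
  **`card_mul_finrank_equivariantTateHom_eq_sum`** (`|G| rk Hom_{ℤ_ℓ[G]}(T_ℓ X, T_ℓ Y) = Σ_g χ_Y(g) χ_X(g⁻¹)`).
* §4 `mem_iInf_eqLocus_leftComp_rightComp_iff`, `tateModuleMap_mem_iInf_eqLocus_of_forall_comp_eq`
  (`T_ℓ` of an equivariant homomorphism is equivariant), **`finrank_equivariantHom_le`**.

Scope (stated, not hidden).  `ℓ` invertible in `K`; `Hom_G(X, Y) ⊆ Hom(X, Y)` and
`Hom_{ℤ_ℓ[G]}(T_ℓ X, T_ℓ Y) ⊆ Hom_{ℤ_ℓ}(T_ℓ X, T_ℓ Y)` are written as intersections of equalisers (`⨅_g eqLocus`, with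
Mathlib's `Preadditive.leftComp/rightComp` and `LinearMap.llcomp/lcomp`); no Tate / Faltings surjectivity is used, so only
the inequality is claimed for `Hom_G(X, Y)`; the values `χ_ℓ(g)` live in `ℤ_ℓ` (their rationality is not asserted).

## References

* [MumfordAV1970] D. Mumford, *Abelian Varieties* (1970), §19 Thm. 3 (pp. 176–178: `ℤ_ℓ ⊗ Hom(X, Y) → Hom(T_ℓ X, T_ℓ Y)`
  injective, `Hom(X, Y)` free of finite rank), Thm. 4 (p. 180).
* [Milne1986AbelianVarieties] J. S. Milne, *Abelian varieties*, in Cornell–Silverman (1986), Lemma 12.2, Thm. 12.5 (pp. 189–190).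
* [Tate1966Endomorphisms] J. Tate, *Endomorphisms of abelian varieties over finite fields*, Invent. Math. 2 (1966), §1 (Main
  Theorem: bijectivity over finite fields).
* [SerreLinearRepresentations1977] J.-P. Serre, *Linear Representations of Finite Groups*, §2.3 (orthogonality, `⟨χ, χ'⟩` and
  `dim Hom_G(V, W)`; Lemma 2 for `Hom(V, W)`), §7.2.
* [LangeRodriguez2022] H. Lange, R. E. Rodríguez, *Decomposition of Jacobians by Prym Varieties*, LNM 2310 (2022), §2.9.1
  Prop. 2.9.3 (PDF p. 46).
* [DokchitserEtAl2022] V. Dokchitser, H. Green, A. Konstantinou, A. Morgan, *Parity of ranks of Jacobians of curves*,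
  arXiv:2211.06357, §3 (additive functor lemma, `F = V_ℓ`).
-/

noncomputable section

open CategoryTheory CategoryTheory.Limits
open Literature.RepresentationTheory.FiniteGroups
open Literature.NumberTheory.DiophantineGeometry
open scoped TensorProduct

universe u

namespace Literature.AlgebraicGeometry.Motives

namespace AbelianVariety

/-! ## §1 `|G| · rk_{ℤ_ℓ} M^G = Σ_g Tr(τ(g) | M)` for a representation on a free `ℤ_ℓ`-module of finite rank -/

section Lattice

variable (ℓ : ℕ) [Fact ℓ.Prime] {M : Type*} [AddCommGroup M] [Module ℤ_[ℓ] M] {G : Type} [Group G] [Fintype G]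
  (τ : G →* Module.End ℤ_[ℓ] M)

/-- `(Σ_g τ(g)) τ(h) = Σ_g τ(g)` (reindex `g ↦ gh`). [cite: SerreLinearRepresentations1977, §2.3] -/
theorem sum_mul_apply_eq_sum (h : G) : (∑ g, τ g) * τ h = ∑ g, τ g := by
  rw [Finset.sum_mul]
  simp_rw [← map_mul]
  exact Fintype.sum_equiv (Equiv.mulRight h) _ _ fun _ ↦ rfl

/-- `τ(h) (Σ_g τ(g)) = Σ_g τ(g)` (reindex `g ↦ hg`). [cite: SerreLinearRepresentations1977, §2.3] -/
theorem apply_mul_sum_eq_sum (h : G) : τ h * ∑ g, τ g = ∑ g, τ g := by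
  rw [Finset.mul_sum]
  simp_rw [← map_mul]
  exact Fintype.sum_equiv (Equiv.mulLeft h) _ _ fun _ ↦ rfl

/-- The norm `N = Σ_g τ(g)` is a quasi-idempotent: `N N = |G| • N`. [cite: SerreLinearRepresentations1977, §2.3] -/
theorem sum_mul_sum_eq_card_smul : (∑ g, τ g) * (∑ g, τ g) = (Fintype.card G : ℤ_[ℓ]) • ∑ g, τ g := by
  rw [Finset.mul_sum]
  simp_rw [sum_mul_apply_eq_sum]
  rw [Finset.sum_const, Finset.card_univ, Nat.cast_smul_eq_nsmul]

/-- `Im N ⊆ M^G` (`τ(h) N = N`), the invariants written as `⋂_g {x | τ(g) x = x}`. [cite: SerreLinearRepresentations1977, §2.3] -/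
theorem range_sum_le_iInf_eqLocus :
    LinearMap.range (∑ g, τ g) ≤ ⨅ g : G, LinearMap.eqLocus (τ g) LinearMap.id := by
  rintro _ ⟨x, rfl⟩
  rw [Submodule.mem_iInf]
  intro h
  refine LinearMap.mem_eqLocus.2 ?_
  rw [LinearMap.id_apply, ← Module.End.mul_apply, apply_mul_sum_eq_sum]

/-- `N x = |G| • x` for `x ∈ M^G`. [cite: SerreLinearRepresentations1977, §2.3] -/
theorem sum_apply_of_mem_iInf_eqLocus {x : M} (hx : x ∈ ⨅ g : G, LinearMap.eqLocus (τ g) LinearMap.id) :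
    (∑ g, τ g) x = (Fintype.card G : ℤ_[ℓ]) • x := by
  rw [Submodule.mem_iInf] at hx
  have hx' : ∀ g, τ g x = x := fun g ↦ by
    have := LinearMap.mem_eqLocus.1 (hx g); rwa [LinearMap.id_apply] at this
  rw [LinearMap.sum_apply]
  simp_rw [hx']
  rw [Finset.sum_const, Finset.card_univ, Nat.cast_smul_eq_nsmul]

variable [Module.Free ℤ_[ℓ] M] [Module.Finite ℤ_[ℓ] M]

/-- **`Tr(N) = |G| · rk Im N`** for the norm `N = Σ_g τ(g)`: `N` factors as `M ↠ Im N ↪ M`, the other composite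
`Im N ↪ M ↠ Im N` is `|G| · id` (`N² = |G| N`), and both composites have the same trace.
[cite: LangeRodriguez2022, §2.9.1 Prop. 2.9.3, proof (PDF p. 46)] [cite: SerreLinearRepresentations1977, §2.3] -/
theorem trace_sum_eq_card_mul_finrank_range :
    LinearMap.trace ℤ_[ℓ] M (∑ g, τ g) =
      Fintype.card G * Module.finrank ℤ_[ℓ] (LinearMap.range (∑ g, τ g)) := by
  set N : Module.End ℤ_[ℓ] M := ∑ g, τ g with hN
  have hfac : (LinearMap.range N).subtype ∘ₗ N.rangeRestrict = N := LinearMap.ext fun _ ↦ rfl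
  have hother : N.rangeRestrict ∘ₗ (LinearMap.range N).subtype = (Fintype.card G : ℤ_[ℓ]) • LinearMap.id := by
    refine LinearMap.ext fun y ↦ Subtype.ext ?_
    obtain ⟨x, hx⟩ := LinearMap.mem_range.1 y.2
    change N (y : M) = (((Fintype.card G : ℤ_[ℓ]) • y : LinearMap.range N) : M)
    rw [Submodule.coe_smul, ← hx, ← Module.End.mul_apply, hN, sum_mul_sum_eq_card_smul, ← hN, LinearMap.smul_apply]
  have htr : LinearMap.trace ℤ_[ℓ] M N =
      LinearMap.trace ℤ_[ℓ] (LinearMap.range N) (N.rangeRestrict ∘ₗ (LinearMap.range N).subtype) := by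
    conv_lhs => rw [← hfac]
    rw [LinearMap.trace_comp_comm']
  rw [htr, hother, map_smul, LinearMap.trace_id, smul_eq_mul]

/-- **`rk Im N = rk M^G`**: `Im N ⊆ M^G` and `|G| · M^G ⊆ Im N` with `|G| ≠ 0` in the domain `ℤ_ℓ`.
[cite: SerreLinearRepresentations1977, §2.3] [cite: DokchitserEtAl2022, §3 (additive functor lemma: composites `|H|`)] -/
theorem finrank_range_sum_eq_finrank_iInf_eqLocus :
    Module.finrank ℤ_[ℓ] (LinearMap.range (∑ g, τ g)) =
      Module.finrank ℤ_[ℓ] (⨅ g : G, LinearMap.eqLocus (τ g) LinearMap.id : Submodule ℤ_[ℓ] M) := by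
  refine le_antisymm (Submodule.finrank_mono (range_sum_le_iInf_eqLocus ℓ τ)) ?_
  set V : Submodule ℤ_[ℓ] M := ⨅ g : G, LinearMap.eqLocus (τ g) LinearMap.id with hV
  -- `x ↦ |G| x : M^G → Im N` is injective
  have hmem : ∀ x : V, (Fintype.card G : ℤ_[ℓ]) • (x : M) ∈ LinearMap.range (∑ g, τ g) := fun x ↦
    LinearMap.mem_range.2 ⟨x, sum_apply_of_mem_iInf_eqLocus ℓ τ x.2⟩
  let f : V →ₗ[ℤ_[ℓ]] LinearMap.range (∑ g, τ g) :=
    LinearMap.codRestrict _ ((Fintype.card G : ℤ_[ℓ]) • V.subtype) fun x ↦ hmem x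
  refine LinearMap.finrank_le_finrank_of_injective (f := f) fun x x' hxx' ↦ ?_
  have h := congrArg Subtype.val hxx'
  change (Fintype.card G : ℤ_[ℓ]) • (x : M) = (Fintype.card G : ℤ_[ℓ]) • (x' : M) at h
  exact Subtype.ext (smul_right_injective M (Nat.cast_ne_zero.2 Fintype.card_ne_zero) h)

/-- **The multiplicity of the trivial representation, lattice form: `|G| · rk_{ℤ_ℓ} M^G = Σ_{g ∈ G} Tr(τ(g) | M)`** for every
representation `τ` of a finite group `G` on a free `ℤ_ℓ`-module `M` of finite rank (`M^G = ⋂_g {x | τ(g)x = x}`; no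
invertibility of `|G|` in `ℤ_ℓ` is needed). [cite: SerreLinearRepresentations1977, §2.3 (⟨χ, 1⟩ = dim V^G)] [cite: LangeRodriguez2022, §2.9.1 Prop. 2.9.3, proof (PDF p. 46)] -/
theorem card_mul_finrank_iInf_eqLocus_eq_sum_trace :
    (Fintype.card G : ℤ_[ℓ]) * Module.finrank ℤ_[ℓ] (⨅ g : G, LinearMap.eqLocus (τ g) LinearMap.id : Submodule ℤ_[ℓ] M) =
      ∑ g, LinearMap.trace ℤ_[ℓ] M (τ g) := by
  rw [← finrank_range_sum_eq_finrank_iInf_eqLocus ℓ τ, ← trace_sum_eq_card_mul_finrank_range ℓ τ, map_sum]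

end Lattice

/-! ## §2 `Tr(f ↦ A ∘ f ∘ B | Hom(M, N)) = Tr A · Tr B` -/

section TwoSided

variable {R : Type*} [CommRing R] {M N : Type*} [AddCommGroup M] [Module R M] [AddCommGroup N] [Module R N]
  [Module.Free R M] [Module.Finite R M] [Module.Free R N] [Module.Finite R N]

/-- **The trace of two-sided composition**: for `A ∈ End N`, `B ∈ End M` (`M`, `N` free of finite rank) the endomorphism
`f ↦ A ∘ f ∘ B` of `Hom(M, N)` has trace `Tr A · Tr B` — under `Hom(M, N) ≅ M^∨ ⊗ N` it is `B^∨ ⊗ A`, and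
`Tr(B^∨ ⊗ A) = Tr B^∨ · Tr A = Tr B · Tr A`. [cite: SerreLinearRepresentations1977, §2.3 (Lemma 2: character of Hom(V, W))] -/
theorem trace_llcomp_comp_lcomp (A : N →ₗ[R] N) (B : M →ₗ[R] M) :
    LinearMap.trace R (M →ₗ[R] N) (LinearMap.llcomp R M N N A ∘ₗ LinearMap.lcomp R N B) =
      LinearMap.trace R N A * LinearMap.trace R M B := by
  let e : Module.Dual R M ⊗[R] N ≃ₗ[R] (M →ₗ[R] N) := dualTensorHomEquiv R M N
  have key : (LinearMap.llcomp R M N N A ∘ₗ LinearMap.lcomp R N B) ∘ₗ e.toLinearMap =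
      e.toLinearMap ∘ₗ TensorProduct.map (Module.Dual.transpose (R := R) B) A := by
    refine TensorProduct.ext' fun φ n ↦ ?_
    refine LinearMap.ext fun m ↦ ?_
    simp [e, dualTensorHomEquiv, LinearMap.llcomp_apply, LinearMap.lcomp_apply, Module.Dual.transpose_apply]
  have hconj : LinearMap.llcomp R M N N A ∘ₗ LinearMap.lcomp R N B =
      e.conj (TensorProduct.map (Module.Dual.transpose (R := R) B) A) := by
    rw [LinearEquiv.conj_apply, ← key, LinearMap.comp_assoc, LinearEquiv.comp_coe, LinearEquiv.symm_trans_self,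
      LinearEquiv.refl_toLinearMap, LinearMap.comp_id]
  rw [hconj]
  refine (LinearMap.trace_conj' (M := Module.Dual R M ⊗[R] N) (N := M →ₗ[R] N) _ e).trans ?_
  refine (LinearMap.trace_tensorProduct' (M := Module.Dual R M) (N := N) _ _).trans ?_
  rw [mul_comm]
  congr 1
  exact LinearMap.trace_transpose' (R := R) (M := M) B

end TwoSided

/-! ## §3 `|G| · rk Hom_{ℤ_ℓ[G]}(T_ℓ X, T_ℓ Y) = Σ_g χ_ℓ^Y(g) χ_ℓ^X(g⁻¹)` -/

section TateHom

variable {K : Type u} [Field K] (ℓ : ℕ) [Fact ℓ.Prime] {X Y : AbelianVariety K} {G : Type} [Group G] [Fintype G]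
  (ρX : G →* End X) (ρY : G →* End Y)

/-- **`|G| · rk_{ℤ_ℓ} (T_ℓ X)^G = Σ_{g ∈ G} Tr(ρ(g) | T_ℓ X)`** for ANY finite-group action `ρ : G → End X` and `ℓ` invertible
in `K` (§1 for `τ = T_ℓ ∘ ρ`; unlike `card_mul_finrank_iInf_eqLocus_eq_sum_trace_tateModuleMap` no endomorphism `N₀` with
`N₀ = Σ_g ρ(g)` has to be named). [cite: SerreLinearRepresentations1977, §2.3] [cite: DokchitserEtAl2022, §3 (additive functor lemma, `F = V_ℓ`)] -/
theorem card_mul_finrank_iInf_eqLocus_tateModuleMap_eq_sum_trace (hℓ : (ℓ : K) ≠ 0) :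
    (Fintype.card G : ℤ_[ℓ]) *
        Module.finrank ℤ_[ℓ] (⨅ g : G, LinearMap.eqLocus (tateModuleMap ℓ (End.asHom (ρX g))) LinearMap.id :
          Submodule ℤ_[ℓ] (X.tateModule ℓ)) =
      ∑ g, LinearMap.trace ℤ_[ℓ] (X.tateModule ℓ) (tateModuleMap ℓ (End.asHom (ρX g))) := by
  haveI := X.module_free_tateModule_holds ℓ hℓ
  haveI := module_finite_tateModule_of_cast_ne_zero X ℓ hℓ
  let τ : G →* Module.End ℤ_[ℓ] (X.tateModule ℓ) :=
    { toFun := fun g ↦ tateModuleMap ℓ (End.asHom (ρX g))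
      map_one' := tateModuleMap_asHom_map_one ℓ ρX
      map_mul' := tateModuleMap_asHom_map_mul ℓ ρX }
  exact card_mul_finrank_iInf_eqLocus_eq_sum_trace ℓ τ

omit [Fintype G] in
/-- **The equivariant maps are the invariants of the conjugation action**: for `f : T_ℓ X → T_ℓ Y`,
`T_ℓ ρ_Y(g) ∘ f ∘ T_ℓ ρ_X(g⁻¹) = f ⟺ T_ℓ ρ_Y(g) ∘ f = f ∘ T_ℓ ρ_X(g)`. [cite: SerreLinearRepresentations1977, §2.3 (Hom_G(V, W) = Hom(V, W)^G)] -/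
theorem llcomp_lcomp_apply_eq_iff (g : G) (f : X.tateModule ℓ →ₗ[ℤ_[ℓ]] Y.tateModule ℓ) :
    (LinearMap.llcomp ℤ_[ℓ] _ _ _ (tateModuleMap ℓ (End.asHom (ρY g))) ∘ₗ
        LinearMap.lcomp ℤ_[ℓ] _ (tateModuleMap ℓ (End.asHom (ρX g⁻¹)))) f = f ↔
      tateModuleMap ℓ (End.asHom (ρY g)) ∘ₗ f = f ∘ₗ tateModuleMap ℓ (End.asHom (ρX g)) := by
  have h1 : tateModuleMap ℓ (End.asHom (ρX g⁻¹)) ∘ₗ tateModuleMap ℓ (End.asHom (ρX g)) = LinearMap.id := by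
    change tateModuleMap ℓ (End.asHom (ρX g⁻¹)) * tateModuleMap ℓ (End.asHom (ρX g)) = 1
    rw [← tateModuleMap_asHom_map_mul, inv_mul_cancel, tateModuleMap_asHom_map_one]
  have h2 : tateModuleMap ℓ (End.asHom (ρX g)) ∘ₗ tateModuleMap ℓ (End.asHom (ρX g⁻¹)) = LinearMap.id := by
    change tateModuleMap ℓ (End.asHom (ρX g)) * tateModuleMap ℓ (End.asHom (ρX g⁻¹)) = 1
    rw [← tateModuleMap_asHom_map_mul, mul_inv_cancel, tateModuleMap_asHom_map_one]
  rw [LinearMap.comp_apply, LinearMap.lcomp_apply', LinearMap.llcomp_apply']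
  constructor
  · intro h
    conv_rhs => rw [← h]
    rw [LinearMap.comp_assoc, LinearMap.comp_assoc, h1, LinearMap.comp_id]
  · intro h
    rw [← LinearMap.comp_assoc, h, LinearMap.comp_assoc, h2, LinearMap.comp_id]

/-- **`|G| · rk_{ℤ_ℓ} Hom_{ℤ_ℓ[G]}(T_ℓ X, T_ℓ Y) = Σ_{g ∈ G} χ_ℓ^Y(g) · χ_ℓ^X(g⁻¹)`** for finite-group actions `ρ_X`, `ρ_Y` on
abelian varieties `X`, `Y` over a field `K` and a prime `ℓ` invertible in `K`: the `ℓ`-adic inner product of the characters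
`χ_ℓ^X(g) = Tr(T_ℓ ρ_X(g))`, `χ_ℓ^Y` counts the `ℤ_ℓ[G]`-equivariant homomorphisms of Tate modules
(`Hom_{ℤ_ℓ[G]} = ⋂_g {f | T_ℓ ρ_Y(g) ∘ f = f ∘ T_ℓ ρ_X(g)}`; §1 for the conjugation action `g · f = T_ℓ ρ_Y(g) f T_ℓ ρ_X(g⁻¹)`,
whose character is `χ_Y(g) χ_X(g⁻¹)` by §2). [cite: SerreLinearRepresentations1977, §2.3 and §7.2 (⟨χ_V, χ_W⟩ = dim Hom_G(V, W))]
[cite: MumfordAV1970, §19 Thm. 3 (p. 176) and Thm. 4 (p. 180)] -/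
theorem card_mul_finrank_equivariantTateHom_eq_sum (hℓ : (ℓ : K) ≠ 0) :
    (Fintype.card G : ℤ_[ℓ]) * Module.finrank ℤ_[ℓ]
        (⨅ g : G, LinearMap.eqLocus (LinearMap.llcomp ℤ_[ℓ] _ _ _ (tateModuleMap ℓ (End.asHom (ρY g))))
          (LinearMap.lcomp ℤ_[ℓ] _ (tateModuleMap ℓ (End.asHom (ρX g)))) :
            Submodule ℤ_[ℓ] (X.tateModule ℓ →ₗ[ℤ_[ℓ]] Y.tateModule ℓ)) =
      ∑ g, LinearMap.trace ℤ_[ℓ] (Y.tateModule ℓ) (tateModuleMap ℓ (End.asHom (ρY g))) *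
        LinearMap.trace ℤ_[ℓ] (X.tateModule ℓ) (tateModuleMap ℓ (End.asHom (ρX g⁻¹))) := by
  haveI := X.module_free_tateModule_holds ℓ hℓ
  haveI := module_finite_tateModule_of_cast_ne_zero X ℓ hℓ
  haveI := Y.module_free_tateModule_holds ℓ hℓ
  haveI := module_finite_tateModule_of_cast_ne_zero Y ℓ hℓ
  -- the conjugation representation on `Hom(T_ℓ X, T_ℓ Y)`
  let τ : G →* Module.End ℤ_[ℓ] (X.tateModule ℓ →ₗ[ℤ_[ℓ]] Y.tateModule ℓ) :=
    { toFun := fun g ↦ LinearMap.llcomp ℤ_[ℓ] _ _ _ (tateModuleMap ℓ (End.asHom (ρY g))) ∘ₗ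
        LinearMap.lcomp ℤ_[ℓ] _ (tateModuleMap ℓ (End.asHom (ρX g⁻¹)))
      map_one' := by
        refine LinearMap.ext fun f ↦ ?_
        rw [inv_one, tateModuleMap_asHom_map_one, tateModuleMap_asHom_map_one, LinearMap.comp_apply,
          LinearMap.lcomp_apply', LinearMap.llcomp_apply', Module.End.one_apply]
        change LinearMap.id ∘ₗ (f ∘ₗ LinearMap.id) = f
        rw [LinearMap.comp_id, LinearMap.id_comp]
      map_mul' := fun g h ↦ by
        refine LinearMap.ext fun f ↦ ?_
        rw [Module.End.mul_apply, LinearMap.comp_apply, LinearMap.comp_apply, LinearMap.comp_apply]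
        simp only [LinearMap.lcomp_apply', LinearMap.llcomp_apply']
        rw [mul_inv_rev, tateModuleMap_asHom_map_mul, tateModuleMap_asHom_map_mul, Module.End.mul_eq_comp,
          Module.End.mul_eq_comp]
        simp only [LinearMap.comp_assoc] }
  have hτ : ∀ g, τ g = LinearMap.llcomp ℤ_[ℓ] _ _ _ (tateModuleMap ℓ (End.asHom (ρY g))) ∘ₗ
      LinearMap.lcomp ℤ_[ℓ] _ (tateModuleMap ℓ (End.asHom (ρX g⁻¹))) := fun _ ↦ rfl
  -- its invariants are the equivariant maps
  have hinv : (⨅ g : G, LinearMap.eqLocus (τ g) LinearMap.id) =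
      ⨅ g : G, LinearMap.eqLocus (LinearMap.llcomp ℤ_[ℓ] _ _ _ (tateModuleMap ℓ (End.asHom (ρY g))))
        (LinearMap.lcomp ℤ_[ℓ] _ (tateModuleMap ℓ (End.asHom (ρX g)))) := by
    refine Submodule.ext fun f ↦ ?_
    simp only [Submodule.mem_iInf, LinearMap.mem_eqLocus, LinearMap.id_apply, hτ, llcomp_lcomp_apply_eq_iff,
      LinearMap.llcomp_apply', LinearMap.lcomp_apply']
  rw [← hinv, card_mul_finrank_iInf_eqLocus_eq_sum_trace ℓ τ]
  exact Finset.sum_congr rfl fun g _ ↦ by rw [hτ]; exact trace_llcomp_comp_lcomp _ _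

end TateHom

/-! ## §4 `rk_ℤ Hom_G(X, Y) ≤ rk_{ℤ_ℓ} Hom_{ℤ_ℓ[G]}(T_ℓ X, T_ℓ Y)` -/

section HomBound

variable {K : Type u} [Field K] (ℓ : ℕ) [Fact ℓ.Prime] {X Y : AbelianVariety K} {G : Type} [Group G]
  (ρX : G →* End X) (ρY : G →* End Y)

omit [Fact ℓ.Prime] in
/-- Membership in `Hom_G(X, Y) = ⋂_g {f | ρ_X(g) ≫ f = f ≫ ρ_Y(g)}`, written with Mathlib's `Preadditive.leftComp` /
`Preadditive.rightComp`. [cite: SerreLinearRepresentations1977, §2.3] -/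
theorem mem_iInf_eqLocus_leftComp_rightComp_iff (f : X ⟶ Y) :
    f ∈ (⨅ g : G, LinearMap.eqLocus (Preadditive.leftComp Y (End.asHom (ρX g))).toIntLinearMap
        (Preadditive.rightComp X (End.asHom (ρY g))).toIntLinearMap : Submodule ℤ (X ⟶ Y)) ↔
      ∀ g, End.asHom (ρX g) ≫ f = f ≫ End.asHom (ρY g) := by
  simp only [Submodule.mem_iInf, LinearMap.mem_eqLocus]
  exact Iff.rfl

/-- **`T_ℓ` of a `G`-equivariant homomorphism is `ℤ_ℓ[G]`-equivariant**: `ρ_X(g) ≫ f = f ≫ ρ_Y(g)` for all `g` gives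
`T_ℓ ρ_Y(g) ∘ T_ℓ f = T_ℓ f ∘ T_ℓ ρ_X(g)` (functoriality of `T_ℓ`). [cite: MumfordAV1970, §19 Thm. 3 (p. 176)] -/
theorem tateModuleMap_mem_iInf_eqLocus_of_forall_comp_eq {f : X ⟶ Y}
    (hf : ∀ g, End.asHom (ρX g) ≫ f = f ≫ End.asHom (ρY g)) :
    tateModuleMap ℓ f ∈
      (⨅ g : G, LinearMap.eqLocus (LinearMap.llcomp ℤ_[ℓ] _ _ _ (tateModuleMap ℓ (End.asHom (ρY g))))
        (LinearMap.lcomp ℤ_[ℓ] _ (tateModuleMap ℓ (End.asHom (ρX g)))) :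
          Submodule ℤ_[ℓ] (X.tateModule ℓ →ₗ[ℤ_[ℓ]] Y.tateModule ℓ)) := by
  rw [Submodule.mem_iInf]
  intro g
  refine LinearMap.mem_eqLocus.2 ?_
  rw [LinearMap.llcomp_apply', LinearMap.lcomp_apply', ← tateModuleMap_comp, ← tateModuleMap_comp, hf]

/-- **`rk_ℤ Hom_G(X, Y) ≤ rk_{ℤ_ℓ} Hom_{ℤ_ℓ[G]}(T_ℓ X, T_ℓ Y)`** for group actions `ρ_X`, `ρ_Y` on abelian varieties `X`, `Y`
over a field `K` and a prime `ℓ` invertible in `K`: `ℤ_ℓ ⊗_ℤ Hom_G(X, Y) → Hom_{ℤ_ℓ}(T_ℓ X, T_ℓ Y)`, `c ⊗ f ↦ c T_ℓ f`, is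
injective (Mumford §19 Thm. 3, the tree's `faltingsTateMap_injective_holds`, composed with `ℤ_ℓ ⊗ Hom_G ↪ ℤ_ℓ ⊗ Hom`, `ℤ_ℓ`
being flat over `ℤ`) with image inside the equivariant maps, and `Hom_G(X, Y) ⊆ Hom(X, Y)` is free of finite rank
(`module_free_hom_holds`, `module_finite_hom_holds`), so `rk_ℤ Hom_G = rk_{ℤ_ℓ}(ℤ_ℓ ⊗ Hom_G) ≤ rk_{ℤ_ℓ} Hom_{ℤ_ℓ[G]}(T_ℓ X, T_ℓ Y)`.
With §3 (for `G` finite): `|G| · rk_ℤ Hom_G(X, Y) ≤ Σ_g χ_ℓ^Y(g) χ_ℓ^X(g⁻¹)`; equality is Tate's conjecture for `(X, Y)/K`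
and is not asserted. [cite: MumfordAV1970, §19 Thm. 3 (pp. 176–178)] [cite: Milne1986AbelianVarieties, Lemma 12.2, Thm. 12.5 (pp. 189–190)]
[cite: SerreLinearRepresentations1977, §2.3] -/
theorem finrank_equivariantHom_le (hℓ : (ℓ : K) ≠ 0) :
    Module.finrank ℤ (⨅ g : G, LinearMap.eqLocus (Preadditive.leftComp Y (End.asHom (ρX g))).toIntLinearMap
        (Preadditive.rightComp X (End.asHom (ρY g))).toIntLinearMap : Submodule ℤ (X ⟶ Y)) ≤
      Module.finrank ℤ_[ℓ]
        (⨅ g : G, LinearMap.eqLocus (LinearMap.llcomp ℤ_[ℓ] _ _ _ (tateModuleMap ℓ (End.asHom (ρY g))))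
          (LinearMap.lcomp ℤ_[ℓ] _ (tateModuleMap ℓ (End.asHom (ρX g)))) :
            Submodule ℤ_[ℓ] (X.tateModule ℓ →ₗ[ℤ_[ℓ]] Y.tateModule ℓ)) := by
  haveI := X.module_free_tateModule_holds ℓ hℓ
  haveI := module_finite_tateModule_of_cast_ne_zero X ℓ hℓ
  haveI := Y.module_free_tateModule_holds ℓ hℓ
  haveI := module_finite_tateModule_of_cast_ne_zero Y ℓ hℓ
  haveI : Module.Free ℤ (X ⟶ Y) := module_free_hom_holds X Y
  haveI : Module.Finite ℤ (X ⟶ Y) := module_finite_hom_holds X Y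
  haveI : Module.IsTorsionFree ℤ (X ⟶ Y) := inferInstance
  set V : Submodule ℤ (X ⟶ Y) := ⨅ g : G, LinearMap.eqLocus (Preadditive.leftComp Y (End.asHom (ρX g))).toIntLinearMap
    (Preadditive.rightComp X (End.asHom (ρY g))).toIntLinearMap with hV
  set W : Submodule ℤ_[ℓ] (X.tateModule ℓ →ₗ[ℤ_[ℓ]] Y.tateModule ℓ) :=
    ⨅ g : G, LinearMap.eqLocus (LinearMap.llcomp ℤ_[ℓ] _ _ _ (tateModuleMap ℓ (End.asHom (ρY g))))
      (LinearMap.lcomp ℤ_[ℓ] _ (tateModuleMap ℓ (End.asHom (ρX g)))) with hW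
  haveI : Module.Free ℤ V := Module.free_of_finite_type_torsion_free'
  -- `ℤ_ℓ ⊗ Hom_G(X, Y) → Hom_{ℤ_ℓ}(T_ℓ X, T_ℓ Y)`, `c ⊗ f ↦ c • T_ℓ f`
  let Ψ : ℤ_[ℓ] ⊗[ℤ] V →ₗ[ℤ_[ℓ]] (X.tateModule ℓ →ₗ[ℤ_[ℓ]] Y.tateModule ℓ) :=
    Representation.IntertwiningMap.toLinearMapl (X.tateRep ℓ) (Y.tateRep ℓ) ∘ₗ faltingsTateMap X Y ℓ ∘ₗ
      V.subtype.baseChange ℤ_[ℓ]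
  have hΨ : Function.Injective Ψ :=
    (Representation.IntertwiningMap.toLinearMap_injective _ _).comp
      ((faltingsTateMap_injective_holds X Y ℓ hℓ).comp
        (Module.Flat.lTensor_preserves_injective_linearMap (M := ℤ_[ℓ]) V.subtype V.injective_subtype))
  have hrange : LinearMap.range Ψ ≤ W := by
    rintro _ ⟨t, rfl⟩
    induction t using TensorProduct.induction_on with
    | zero => rw [map_zero]; exact W.zero_mem
    | tmul c v =>
      have hv : tateModuleMap ℓ (v : X ⟶ Y) ∈ W :=
        tateModuleMap_mem_iInf_eqLocus_of_forall_comp_eq ℓ ρX ρY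
          ((mem_iInf_eqLocus_leftComp_rightComp_iff ρX ρY _).1 v.2)
      have hΨv : Ψ (c ⊗ₜ v) = c • tateModuleMap ℓ (v : X ⟶ Y) := by
        simp only [Ψ, LinearMap.comp_apply, LinearMap.baseChange_tmul, Submodule.subtype_apply, faltingsTateMap_tmul,
          Representation.IntertwiningMap.toLinearMapl_apply, Representation.IntertwiningMap.toLinearMap_smul,
          homToTate_apply, toLinearMap_tateIntertwiningMap]
      rw [hΨv]
      exact W.smul_mem c hv
    | add s t hs ht => rw [map_add]; exact W.add_mem hs ht
  calc Module.finrank ℤ V = Module.finrank ℤ_[ℓ] (ℤ_[ℓ] ⊗[ℤ] V) := Module.finrank_baseChange.symm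
    _ = Module.finrank ℤ_[ℓ] (LinearMap.range Ψ) := (LinearMap.finrank_range_of_inj hΨ).symm
    _ ≤ Module.finrank ℤ_[ℓ] W := Submodule.finrank_mono hrange

end HomBound

end AbelianVariety

end Literature.AlgebraicGeometry.Motives
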